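import Summits.QuantumFields.YangMills.Theorems.BalabanUVNodesN07PureGaugeShift168
import Summits.QuantumFields.YangMills.Theorems.BalabanUVNodesN07LocalLettersHBSummand
import Summits.QuantumFields.YangMills.Theorems.BalabanUVNodesN07FlatHOfCoarseGradient
import Literature.MathematicalPhysics.QuantumFieldTheory.BalabanImbrieJaffe1984to88.BIJ85Sigma422Eta
import Literature.MathematicalPhysics.QuantumFieldTheory.Balaban1983to89.B5Prop11FlatSliceCurlCoercivity
import HarnessLib

/-!
# N07 [B11] (= [15] = [Balaban1985Variational]) Sect. F, road of record R0′, WIDTH-209 row (r2), FILE 3: **THE TWO INPUTS OF THE (r2) KERNEL AT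
# NODE 00's OBJECTS — the shift summand `G := H_V X` of road R0′ (`∂μ = H(∂_cλ)`) IS CURL-FREE when the datum is (componentwise) an averaged
# fine pure gauge `Q(∂m)`, and its three (165)-letters are `< t` for every `t > 2CB₃ς` at a LEVEL-UNIFORM datum `‖X(c)‖ ≤ ς·L^{k−j(c)}`; hence
# g0's `N07PureGaugeShift168.regularTwo_of_curlFreeShift` with the binder `hG` DISCHARGED for the R0′ object**

Cell `pub-ymgap`, width seat `pub-ymgap-dag-n07-w8` g2 (director-ym R405 ∕ №209 second wave; harness re-seat of the base after g0's p608198 · p609716),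
WIDTH-209 N07 row (r2) of the road of record R0′ (plan g83 WORDS-2; TABLE v65 «(r2) n07-w8»; lane owner dag-n07-e g20 I.30615 «GO from the lane, disjoint
from (r4)»; S6 head dag-n07-w4 g3 I.30627 «`G`'s curl-freeness + letters at the object are yours; my INTENT-2 clause consumes them by `exact`»).
`--kind proof --supports stmt-QuantumFields-20542 --as helper`; count-neutral; def-free.
[15] = T. Bałaban, *The variational problem and background fields in renormalization group method for lattice gauge theories*, Commun. Math. Phys. **102**
(1985) 277–309 [Balaban1985Variational]; [4] = *Propagators and renormalization transformations for lattice gauge theories. II*, CMP **96** (1984) 223–250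
[Balaban1984PropagatorsII]; [I.4] = *… I*, CMP **95** (1984) 17–40 [Balaban1984PropagatorsI]; [6] = *Spaces of regular gauge field configurations on a
lattice and gauge fixing conditions*, CMP **99** (1985) 75–102 [Balaban1985RegularSpaces].

THE PRINT.  [15] p. 302 (157): *«A = HB‴ − HD(A₁ + HB‴) + A₁ … H = GQ*(QGQ*)⁻¹»*; p. 304 (168): *«This and the inequality (1.54) of [6] imply |U₁(∂p) − 1| <
ε′ + 86dε′² < 2ε′ on Δ₀»*; p. 288: *«suppressed matrix indices»* (the datum is `𝔤`-valued, the operators act componentwise); [4] p. 228 (2.35) `H`; p. 224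
(2.5) the energy `½‖∂A‖²`, (2.9)∕(2.12) the gauge conditions; [I.4] p. 20 (1.20) *«Q_k∂ = ∂^{(k)}Q′_k»*.  ROAD R0′ (plan g83 WORDS-2, cell bus 2026-08-28
I.29397): the axial→Landau shear of [6] Thm 2's `u` is carried as a COARSE PURE GAUGE datum `∂_cλ` and absorbed at linear order EXACTLY by `H(∂_cλ) = ∂μ`
(dag-n07-w7 `N07FlatHOfCoarseGradient`: `H(Q∂μ₀) = ∂(μ₀ − n)`, hence zero plaquette variables `dcE_hOp_QE_dE_V1`); g0's (r2) kernel p609716 then shows that a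
CURL-FREE summand `G` of the potential is invisible to the linear parts of the class (2) — under two ASSUMED binders: `hG` («`∂^ξG = 0`») and the `t`-letters of the
full potential.  THIS FILE supplies both for the R0′ object `G := H_V X` at NODE 00's carriers.

WHAT IS PROVED (sorry-free; no definition; axioms standard; everything consumed BY NAME).  `flatH P k D` = k0-s1-w3's pin of print's `H` (lattice factor `Lᵏ = η_k⁻¹`,
`a ≡ 1`); `H_V` = its componentwise extension to `M_N(ℂ)`-valued data, entering ONLY through the kernel formula `hHV : (H_V A)(b) = Σ_c (H e_c)(b)·A(c)` (the
`HV` binder of dag-n07-w4's `N07LocalLettersHBSummand.letters10On_HB_of_core_adm22_T4`, verbatim); the datum `X : 𝔅 → M_N(ℂ)`.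
* §1 (the curl binder — «`H ∘ Q` PRESERVES CURL-FREENESS») `curl_flatH_QE_of_curlFree` — REAL LEVEL: for every fine real bond field `A` with `∂^{Lᵏ}A = 0`,
  `(∂^{Lᵏ}(H(QA)))(p) = 0` at every plaquette (gauge-fix `A` in its `Q`-class by lit-balaban `RE_range` ∕ `QE_dE_eq_zero` ∕ `RE_comp_RE` to an admissible FLAT
  competitor, which therefore IS `H(QA)`: n07-w7 `isCritical_of_admissible_of_dc_eq_zero` + lit-balaban `isCritical_iff_eq_hOp`; `flatH = hOp(GE, QsE, EE)` by `rfl`);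
  `curl_flatH_QE_dE` — the pure-gauge instance `(∂^{Lᵏ}(H(Q∂m)))(p) = 0` (n07-w7's `dcE_hOp_QE_dE_V1` read on functions); ★★
  `curlA_extension_eq_zero_of_componentwise_curlFree` — MATRIX LEVEL: if every real component `c ↦ r·Re(u·f(X c))` of the duality class is `QA` for some curl-free
  fine real `A`, then `Sect2.curlA η_k (H_V X) y ν μ = 0` for ALL `y, ν, μ` (n07-w4's `reFunctional_extension` «`φ∘(H_V X) = H(φ∘X)`» + stencil dictionary
  `apply_curlA_of_lt∕gt` + ym3-torus's duality lemma `norm_le_of_forall_reFunctional` at `q = 0`); ★★ `curlA_extension_eq_zero_of_componentwise` — the pure-gauge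
  instance (components `Q(∂m)`); `codiffCurlA_extension_eq_zero_of_componentwise` (so the third (165)-letter of the shift summand is even `0`);
  `componentwise_of_bondAvgIter_grad` ∕ `componentwise_curlFree_of_bondAvgIter_curlFree` — the data `X(c) = (Q_{j(c)}(∂^{Lᵏ}M))(c)` of a fine MATRIX gauge function
  `M`, resp. `X(c) = (Q_{j(c)}A_f)(c)` of a curl-free fine MATRIX field `A_f`, qualify (lit-balaban `map_bondAvgIter`: `Q_j` commutes with real-linear maps of the values;
  by (1.20) the first is the coarse pure gauge `∂^{(j)}(Q′_jM)` = road R0′'s `∂_cλ`, `λ_j = Q′_jM`); ★★ `curlA_extension_eq_zero_of_bondAvgIter_grad` ∕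
  ★★ `curlA_extension_eq_zero_of_bondAvgIter_curlFree` — the `hG` binder of p609716 for `G := H_V(Q∂M)` resp. `G := H_V(QA_f)`.
* §2 (the letters — the `H`-half of g0's located size line, cell bus I.30279) ★ `letters10On_extension_of_uniformDatum_adm22_T4` — on NODE 00's four-tori, for every
  admissible tower `D` (`Adm22`), window `Y` of top-level sites and datum with `‖X(c)‖ ≤ ς·L^{(K−n)−j(c)}` at EVERY cell: `Letters10On Y η_{K−n} t (H_V X)` for every
  `t > 2CB₃ς` — n07-w4's `letters10On_HB_of_core_adm22_T4` at `(C_d, M_Δ, ε₁, ε, θ, R′) := (1, 1, ς, ς, 8CB₃, 0)`: NO collar to the lower cells, NO (163′) condition for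
  this summand (`ς = O(σ)` in the letters of row (r4), dag-n07-e `Node00/ShearedDatumCentred` ∕ n07-w6 (r4-rec)).
* §3 ★★ `regularTwo_of_componentwisePureGaugeShift` ∕ `regularTwo_of_coarsePureGaugeShift` — p609716 ★★★ RE-KEYED: both members of (2) inside `Y`,
  `PlaqSmallOn (plaqInside Y) ((2t₀ + 24t²)η_k²) U ∧ Sect2.CoDivSmallOn (bondsDeep Y) ((t₀ + 32dt²)η_k³) U`, for the potential `A₀ + H_V X` with `hG` DISCHARGED by §1
  and `0 < η_k ≤ 1` supplied (the remaining binders — gauge equation, `t`∕`t₀`-letters, `32t ≤ 1` — are the head's, as in p609716).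
HONEST SCOPE.  Count-neutral kernel bookkeeping: finite-dimensional linear algebra of [4] Sect. 2 on lit-balaban's V1 model (BY NAME), finite differences on the torus,
Hahn–Banach duality in `M_N(ℂ)` (BY NAME).  DISPLAYED, NOT discharged here: that road R0′'s actual shear datum has the componentwise pure-gauge form (the (r0)∕(r1)∕(r4)
records + [4] (1.20) + `QpE_surjective` in the knit's currency), its size `ς`, the tower∕window hypotheses of P12, the gauge equation and the `t₀`-letters of print's
part `A₀`.  Nothing of [15]∕[6]∕[4] ANALYSIS is asserted; the tokens `LocalLetters165TopStep(Core)` ∕ `HalvingStepTop(Core)` ∕ `stub_prop8StepCoP13` are NOT discharged;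
K0⁷ ∕ K1⁷ NOT closed; N07 NOT discharged; counts unmoved (typed 28∕28 · discharged 5∕27); one finite 𝕋⁴ programme at fixed ε — R4-the-rung closes the conditional
finite-𝕋⁴ `BalabanLadder.UV` ONLY; the YM mass gap (Clay) is NOT proved by any of this; nothing continuum ∕ ℝ⁴ ∕ OS.  No `sorry`, no `def`, no `instance`, no `notation`.

RELATED IN THE TREE, NOT DUPLICATED (stem check 2026-08-28T07:10Z: `ls …/Theorems | grep -i 'PureGaugeShiftLetters\|ShiftSummand\|UniformDatum'` = ∅; `rg 'curlA_extension|
curl_flatH|componentwise_of_bondAvgIter|componentwise_curlFree|letters10On_extension_of_uniform|regularTwo_of_coarsePureGauge|regularTwo_of_componentwise'` over lean∕ = ∅): n07-w7's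
`N07FlatHOfCoarseGradient` §4 (the REAL identity `H(Q∂μ₀) = ∂(μ₀ − n)` and `dcE … = 0` on the V1 carriers — CONSUMED, the matrix∕`Sect2.curlA` statement is new) and
`N07FlatHFeasibility` (abstract carrier: feasibility by count, `hOp_datum_split`); n07-w4's `N07Letters10OfExtension` ∕ `N07Letters10OfRealRows` ∕ `N07LocalLettersHBSummand`
(the `HB` summand at NEAR∕FAR data with collar and (163′) — CONSUMED; the uniform-datum specialisation without collar is new) and `N07LocalLettersCoreOfDatumGauges`
(`Letters10On.add∕sub`, the head's door algebra — not restated); g0's `N07PureGaugeShift168` (the kernel with `hG` ASSUMED — CONSUMED).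

References: [15] (2) p. 278, (157) p. 302, (161)–(165) pp. 303–304, (168) p. 304, p. 288; [4] (2.5) p. 224, (2.9)–(2.12) p. 225, (2.35) p. 228, (2.60) p. 234,
Cor. 2.8 (2.150)–(2.151) p. 249; [I.4] (1.18)–(1.20) p. 20; [6] (1.2) p. 76, (1.7)–(1.9) p. 77, (1.54) p. 85.
-/

set_option autoImplicit false

noncomputable section
open scoped BigOperators Matrix.Norms.L2Operator

namespace Summit.QuantumFields.YangMills.BalabanUVNodes.N07PureGaugeShiftLetters

open Literature.MathematicalPhysics.QuantumFieldTheory.Balaban1983to89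
open Literature.MathematicalPhysics.QuantumFieldTheory.Balaban1983to89.Node00
open LatticeFieldCalculus (curl bondAvgIter)
open B6SectADomainsV1 (Domains)
open B6SectAOperatorsV1 (ScalarSpace BondIdx dE dcE QE QsE dcE_apply)
open B6SectAVectorModelV1 (GE EE)
open Summit.QuantumFields.YangMills.Theorems.K0FlatCubeOpsTextP (flatH IsLevWeight)
open Summit.QuantumFields.YangMills.BalabanUVNodes.N07HalvingStepTopOfLocalLetters (Letters10On)
open Summit.QuantumFields.YangMills.BalabanUVNodes.N07Letters10OfExtension (reFunctional_extension reFunctional_extension_apply)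
open Summit.QuantumFields.YangMills.BalabanUVNodes.N07Letters10OfRealRows (apply_curlA_of_lt apply_curlA_of_gt reFunctional_add
  reFunctional_smul)
open Summit.QuantumFields.YangMills.Theorems.N07FlatHOfCoarseGradient (dcE_hOp_QE_dE_V1)
open Summit.QuantumFields.YangMills.Theorems.HalvingQuarterMatrix (norm_le_of_forall_reFunctional)
open Literature.MathematicalPhysics.QuantumFieldTheory.BalabanImbrieJaffe1984to88.BIJ85Sigma422Eta (eta_inv eta_pos)
open Literature.MathematicalPhysics.QuantumFieldTheory.BalabanImbrieJaffe1984to88.BIJ85AxialPropagator411 (BondSpace PlaqSpace)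
open B5Prop11FlatSliceCurlCoercivity (map_bondAvgIter)

variable {P : Params} {N : ℕ}

/-! ## §1  The shift summand `G = H_V X` of road R0′ is curl-free -/

section CurlFree

variable {k : ℕ} {D : Domains P}

open B6SectAOperatorsV1 (dsE RE RE_range RE_comp_RE QpE)
open B6SectACriticalPointV1 (dcE_comp_dE QE_dE_eq_zero isCritical_iff_eq_hOp)
open B6Eq218Lagrangian (Admissible)
open Summit.QuantumFields.YangMills.Theorems.N07FlatHOfCoarseGradient (isCritical_of_admissible_of_dc_eq_zero)

/-- **REAL LEVEL: `H ∘ Q` PRESERVES CURL-FREENESS** — for every fine real bond field `A` with zero plaquette variables `∂^{Lᵏ}A = 0`, print's `H` at the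
averaged datum `QA` has zero plaquette variables, `(∂^{Lᵏ}(H(QA)))(p) = 0`: gauge-fix `A` inside its `Q`-class (`n ∈ N(Q′)` with `R∂*A = ∂*∂n`, lit-balaban `RE_range`;
`Q∂n = 0`, `QE_dE_eq_zero`; `R² = R`, `RE_comp_RE`), so `A − ∂n` is an ADMISSIBLE FLAT competitor, hence THE critical configuration `H(QA)` (dag-n07-w7
`isCritical_of_admissible_of_dc_eq_zero` + lit-balaban `isCritical_iff_eq_hOp`); read on functions through `flatH = hOp(GE, QsE, EE)` (`rfl`).  On the torus the curl-free
fields are the pure gauges plus the constant (harmonic) one-forms. [cite: Balaban1984PropagatorsII, (2.5)–(2.6) p.224, (2.9)–(2.12) p.225, (2.35) p.228; Balaban1985Variational, (157) p.302, (168) p.304] -/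
theorem curl_flatH_QE_of_curlFree (A : BondSpace P) (hA : dcE ((P.L : ℝ) ^ k) A = 0) (p : Plaq P 0) :
    curl ((P.L : ℝ) ^ k) (flatH P k D (WithLp.ofLp (QE D A))) p = 0 := by
  have hc : ((P.L : ℝ) ^ k) ≠ 0 := pow_ne_zero _ (Nat.cast_ne_zero.2 P.L_pos.ne')
  -- gauge-fix `A` inside its `Q`-class: `n ∈ N(Q′)` with `R∂*A = ∂*∂n`
  obtain ⟨n, hn, hRn⟩ := RE_range D ((P.L : ℝ) ^ k) (dsE ((P.L : ℝ) ^ k) A)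
  have hadm : Admissible (QE D) (dsE ((P.L : ℝ) ^ k)) (RE D ((P.L : ℝ) ^ k)) (QE D A) (A - dE ((P.L : ℝ) ^ k) n) := by
    refine ⟨?_, ?_⟩
    · rw [map_sub, QE_dE_eq_zero D _ n hn, sub_zero]
    · have hRR : RE D ((P.L : ℝ) ^ k) (RE D ((P.L : ℝ) ^ k) (dsE ((P.L : ℝ) ^ k) A)) = RE D ((P.L : ℝ) ^ k) (dsE ((P.L : ℝ) ^ k) A) := by
        simpa only [LinearMap.coe_comp, Function.comp_apply] using LinearMap.congr_fun (RE_comp_RE D ((P.L : ℝ) ^ k)) (dsE ((P.L : ℝ) ^ k) A)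
      rw [map_sub, map_sub, ← hRn, hRR, sub_self]
  -- the competitor is flat: `∂(A − ∂n) = ∂A − ∂∂n = 0`
  have h0 : dcE ((P.L : ℝ) ^ k) (A - dE ((P.L : ℝ) ^ k) n) = 0 := by
    rw [map_sub, hA, zero_sub, neg_eq_zero]
    simpa only [LinearMap.coe_comp, Function.comp_apply, LinearMap.zero_apply] using
      LinearMap.congr_fun (dcE_comp_dE (P := P) ((P.L : ℝ) ^ k)) n
  have hcrit := isCritical_of_admissible_of_dc_eq_zero (dc := dcE ((P.L : ℝ) ^ k)) hadm h0
  have heq := (isCritical_iff_eq_hOp D hc (w := fun _ => (1 : ℝ)) (fun _ => one_pos) (QE D A) (A - dE ((P.L : ℝ) ^ k) n)).mp hcrit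
  have hp := congrArg (fun x : PlaqSpace P => x p) h0
  rw [heq] at hp
  simpa [flatH, dcE_apply] using hp

/-- **REAL LEVEL: print's `H` at an averaged fine pure gauge has zero plaquette variables** — `(∂^{Lᵏ}(H(Q∂m)))(p) = 0` for the
plain-function operator `flatH P k D` (k0-s1-w3's pin of `H = GQ*(QGQ*)⁻¹`, lattice factor `Lᵏ = η⁻¹`, `a ≡ 1`): dag-n07-w7's `dcE_hOp_QE_dE_V1`
(`H(Q∂μ₀) = ∂(μ₀ − n)`, `∂∂ = 0`) read on functions. [cite: Balaban1984PropagatorsII, (2.5) p.224, (2.35) p.228; Balaban1985Variational, (157) p.302] -/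
theorem curl_flatH_QE_dE (m : ScalarSpace P) (p : Plaq P 0) :
    curl ((P.L : ℝ) ^ k) (flatH P k D (WithLp.ofLp (QE D (dE ((P.L : ℝ) ^ k) m)))) p = 0 := by
  have h := dcE_hOp_QE_dE_V1 D (c := (P.L : ℝ) ^ k) (pow_ne_zero _ (Nat.cast_ne_zero.2 P.L_pos.ne'))
    (w := fun _ => (1 : ℝ)) (fun _ => one_pos) m
  have hp := congrArg (fun x : PlaqSpace P => x p) h
  simpa [flatH, dcE_apply] using hp

/-- **★★ MATRIX LEVEL: `H_V ∘ Q` PRESERVES CURL-FREENESS.**  Let `H_V` be the componentwise extension to `M_N(ℂ)`-valued data of print's `H` (k0-s1-w3's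
`flatH P k D`; kernel formula `hHV` = the `HV` binder of dag-n07-w4's `letters10On_HB_of_core_adm22_T4`) and let EVERY real component `c ↦ r·Re(u·f(X c))` of the matrix
datum `X : 𝔅 → M_N(ℂ)` (duality class) be the multi-scale average `QA` of SOME fine real bond field `A` with zero plaquette variables.  Then `G := H_V X` has ZERO LATTICE
CURL at the unit `η_k = L^{−k}`: `(∂^{η_k}G)(p_{νμ}(y)) = 0` for all `y, ν, μ`.  Proof: `φ ∘ (H_V X) = flatH(φ ∘ X)` (n07-w4 `reFunctional_extension`), `curl_flatH_QE_of_curlFree`,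
n07-w4's stencil dictionary `apply_curlA_of_lt∕gt` with `η_k⁻¹ = Lᵏ` (`eta_inv`), and `‖M‖ ≤ 0` once every duality functional of `M` vanishes (ym3-torus
`norm_le_of_forall_reFunctional`). [cite: Balaban1985Variational, (168) p.304, (157) p.302, p.288; Balaban1984PropagatorsII, (2.5) p.224, (2.35) p.228; Balaban1985RegularSpaces, (1.2) p.76] -/
theorem curlA_extension_eq_zero_of_componentwise_curlFree
    {HV : (BondIdx D → MatA N) →ₗ[ℂ] (PBond P 0 → MatA N)}
    (hHV : ∀ (A : BondIdx D → MatA N) (b : PBond P 0), HV A b = ∑ c, ((flatH P k D (Pi.single c 1) b : ℝ) : ℂ) • A c)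
    {X : BondIdx D → MatA N}
    (hX : ∀ (f : StrongDual ℂ (MatA N)) (u : ℂ) (r : ℝ), ∃ A : BondSpace P,
      dcE ((P.L : ℝ) ^ k) A = 0 ∧ (fun c => r * (u * f (X c)).re) = WithLp.ofLp (QE D A))
    (y : Site P 0) (ν μ : Fin P.d) :
    Sect2.curlA (P.eta k) (HV X) y ν μ = 0 := by
  have hφ : ∀ (f : StrongDual ℂ (MatA N)) (u : ℂ) (r : ℝ), r * (u * f (Sect2.curlA (P.eta k) (HV X) y ν μ)).re = 0 := by
    intro f u r
    obtain ⟨A, hA, hm⟩ := hX f u r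
    have hre : (fun b => r * (u * f (HV X b)).re) = flatH P k D (WithLp.ofLp (QE D A)) := by
      rw [reFunctional_extension (flatH P k D) hHV f u r X, hm]
    rcases lt_trichotomy ν μ with h | h | h
    · rw [apply_curlA_of_lt (φ := fun M => r * (u * f M).re) (reFunctional_add f u r) (reFunctional_smul f u r) _ _ _ h, hre, eta_inv]
      exact curl_flatH_QE_of_curlFree A hA ⟨y, ν, μ, h⟩
    · subst h
      rw [Sect2.curlA_self, map_zero, mul_zero, Complex.zero_re, mul_zero]
    · rw [apply_curlA_of_gt (φ := fun M => r * (u * f M).re) (reFunctional_add f u r) (reFunctional_smul f u r) _ _ _ h, hre, eta_inv,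
        curl_flatH_QE_of_curlFree A hA ⟨y, μ, ν, h⟩, neg_zero]
  have hn : ‖Sect2.curlA (P.eta k) (HV X) y ν μ‖ ≤ 0 :=
    norm_le_of_forall_reFunctional _ le_rfl fun f u r _ => (hφ f u r).le
  exact norm_le_zero_iff.mp hn

/-- **★★ THE SHIFT SUMMAND OF ROAD R0′ IS CURL-FREE AT NODE 00's OBJECTS.**  Let `H_V` be the componentwise extension to `M_N(ℂ)`-valued data of
print's `H` (k0-s1-w3's `flatH P k D`, kernel formula `hHV` — the `HV` of dag-n07-w4's `letters10On_HB_of_core_adm22_T4`), and let the matrix datum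
`X : 𝔅 → M_N(ℂ)` be COMPONENTWISE AN AVERAGED FINE PURE GAUGE: every real component `c ↦ r·Re(u·f(X c))` of the duality class is `Q(∂m)` for some
fine scalar `m` ([4] (1.20): `Q∂μ₀ = ∂^{(j)}Q′_jμ₀` — the coarse pure gauge `∂_cλ` of rows (r0)∕(r1), `λ = Q′μ₀`).  Then the bond field `G := H_V X`
(road R0′'s `∂μ = H(∂_cλ)`, dag-n07-w7 (B)) has ZERO LATTICE CURL at the unit `η_k = L^{−k}`: `(∂^{η_k}G)(p_{νμ}(y)) = 0` for all `y, ν, μ` — the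
binder `hG` of `N07PureGaugeShift168.regularTwo_of_curlFreeShift` DISCHARGED for the R0′ object.  Proof: `φ ∘ (H_V X) = flatH(φ ∘ X)` (n07-w4
`reFunctional_extension`), `curl_flatH_QE_dE`, n07-w4's stencil dictionary `apply_curlA_of_lt∕gt`, and `‖M‖ = 0` once every duality functional of `M`
vanishes (ym3-torus `norm_le_of_forall_reFunctional`). [cite: Balaban1985Variational, (168) p.304, (157) p.302, p.288; Balaban1984PropagatorsII, (2.5) p.224, (2.35) p.228; Balaban1985RegularSpaces, (1.2) p.76] -/
theorem curlA_extension_eq_zero_of_componentwise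
    {HV : (BondIdx D → MatA N) →ₗ[ℂ] (PBond P 0 → MatA N)}
    (hHV : ∀ (A : BondIdx D → MatA N) (b : PBond P 0), HV A b = ∑ c, ((flatH P k D (Pi.single c 1) b : ℝ) : ℂ) • A c)
    {X : BondIdx D → MatA N}
    (hX : ∀ (f : StrongDual ℂ (MatA N)) (u : ℂ) (r : ℝ), ∃ m : ScalarSpace P,
      (fun c => r * (u * f (X c)).re) = WithLp.ofLp (QE D (dE ((P.L : ℝ) ^ k) m)))
    (y : Site P 0) (ν μ : Fin P.d) :
    Sect2.curlA (P.eta k) (HV X) y ν μ = 0 :=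
  curlA_extension_eq_zero_of_componentwise_curlFree hHV (fun f u r => by
    obtain ⟨m, hm⟩ := hX f u r
    exact ⟨dE ((P.L : ℝ) ^ k) m, by
      simpa only [LinearMap.coe_comp, Function.comp_apply, LinearMap.zero_apply] using
        LinearMap.congr_fun (dcE_comp_dE (P := P) ((P.L : ℝ) ^ k)) m, hm⟩) y ν μ

/-- … hence also its co-differential-of-curl `∂^{η_k*}∂^{η_k}(H_V X)` vanishes (third letter of (165)∕(167) for the shift summand).
[cite: Balaban1985Variational, (167)–(168) p.304; Balaban1985RegularSpaces, (1.2) p.76] -/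
theorem codiffCurlA_extension_eq_zero_of_componentwise
    {HV : (BondIdx D → MatA N) →ₗ[ℂ] (PBond P 0 → MatA N)}
    (hHV : ∀ (A : BondIdx D → MatA N) (b : PBond P 0), HV A b = ∑ c, ((flatH P k D (Pi.single c 1) b : ℝ) : ℂ) • A c)
    {X : BondIdx D → MatA N}
    (hX : ∀ (f : StrongDual ℂ (MatA N)) (u : ℂ) (r : ℝ), ∃ m : ScalarSpace P,
      (fun c => r * (u * f (X c)).re) = WithLp.ofLp (QE D (dE ((P.L : ℝ) ^ k) m)))
    (x : Site P 0) (μ : Fin P.d) :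
    Sect2.codiffCurlA (P.eta k) (HV X) x μ = 0 :=
  N07PureGaugeShift168.codiffCurlA_eq_zero_of_curlFree (P.eta k) (curlA_extension_eq_zero_of_componentwise hHV hX) x μ

/-- **THE DATUM OF ROAD R0′ QUALIFIES**: if the matrix datum is the multi-scale average of a fine MATRIX pure gauge, `X(c) = (Q_{j(c)}(∂^{Lᵏ}M))(c)`
(`M : T_η → M_N(ℂ)` a fine gauge function; by [4] (1.20) `Q_j∂ = ∂^{(j)}Q′_j` this is the coarse pure gauge `∂_cλ` of the block means `λ_j = Q′_jM` —
rows (r0)∕(r1)), then every real component of `X` is the averaged fine pure gauge `Q(∂m)` of the component `m = φ ∘ M` (`Q_j` and `∂` commute with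
real-linear maps of the values: lit-balaban `map_bondAvgIter`). [cite: Balaban1984PropagatorsI, (1.18)–(1.20) p.20; Balaban1985Variational, p.288, (157) p.302] -/
theorem componentwise_of_bondAvgIter_grad {X : BondIdx D → MatA N} (M : Site P 0 → MatA N)
    (hXM : ∀ c : BondIdx D, X c = bondAvgIter (c.1.1 : ℕ) (LatticeFieldCalculus.grad ((P.L : ℝ) ^ k) M) c.1.2)
    (f : StrongDual ℂ (MatA N)) (u : ℂ) (r : ℝ) :
    ∃ m : ScalarSpace P, (fun c => r * (u * f (X c)).re) = WithLp.ofLp (QE D (dE ((P.L : ℝ) ^ k) m)) := by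
  -- the duality functional as a real-linear map of the values
  let φL : MatA N →ₗ[ℝ] ℝ :=
    { toFun := fun A => r * (u * f A).re
      map_add' := reFunctional_add f u r
      map_smul' := fun a A => by
        rw [RingHom.id_apply, smul_eq_mul, ← algebraMap_smul ℂ a A]
        exact reFunctional_smul f u r a A }
  refine ⟨WithLp.toLp 2 fun s => φL (M s), funext fun c => ?_⟩
  show φL (X c) = bondAvgIter (c.1.1 : ℕ) (LatticeFieldCalculus.grad ((P.L : ℝ) ^ k) fun s => φL (M s)) c.1.2
  rw [hXM c, map_bondAvgIter φL (le_trans (Nat.lt_succ_iff.mp c.1.1.isLt) D.hk)]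
  congr 1
  funext b
  simp only [LatticeFieldCalculus.grad, map_smul, map_sub, smul_eq_mul]

/-- **★★ THE SHIFT SUMMAND `H_V(Q∂M)` IS CURL-FREE** (`curlA_extension_eq_zero_of_componentwise` ∘ `componentwise_of_bondAvgIter_grad`): for every fine
matrix gauge function `M`, the bond field `H_V X`, `X(c) = (Q_{j(c)}(∂^{Lᵏ}M))(c)`, has `(∂^{η_k}(H_V X))(p_{νμ}(y)) = 0` at every plaquette — the
`hG` binder of `N07PureGaugeShift168.regularTwo_of_curlFreeShift` for road R0′'s `G = ∂μ = H(∂_cλ)`.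
[cite: Balaban1985Variational, (168) p.304, (157) p.302; Balaban1984PropagatorsII, (2.35) p.228; Balaban1984PropagatorsI, (1.20) p.20] -/
theorem curlA_extension_eq_zero_of_bondAvgIter_grad
    {HV : (BondIdx D → MatA N) →ₗ[ℂ] (PBond P 0 → MatA N)}
    (hHV : ∀ (A : BondIdx D → MatA N) (b : PBond P 0), HV A b = ∑ c, ((flatH P k D (Pi.single c 1) b : ℝ) : ℂ) • A c)
    {X : BondIdx D → MatA N} (M : Site P 0 → MatA N)
    (hXM : ∀ c : BondIdx D, X c = bondAvgIter (c.1.1 : ℕ) (LatticeFieldCalculus.grad ((P.L : ℝ) ^ k) M) c.1.2)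
    (y : Site P 0) (ν μ : Fin P.d) :
    Sect2.curlA (P.eta k) (HV X) y ν μ = 0 :=
  curlA_extension_eq_zero_of_componentwise hHV (componentwise_of_bondAvgIter_grad M hXM) y ν μ

/-- **A CURL-FREE FINE MATRIX FIELD QUALIFIES**: if the matrix datum is the multi-scale average `X(c) = (Q_{j(c)}A_f)(c)` of a fine MATRIX bond field `A_f` with
zero plaquette variables `∂^{Lᵏ}A_f = 0` (e.g. a pure gauge `∂^{Lᵏ}M`, or a pure gauge plus a constant one-form), then every real component of `X` is `QA` for the
curl-free real field `A = φ ∘ A_f` (`Q_j` and `∂` commute with real-linear maps of the values: lit-balaban `map_bondAvgIter`).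
[cite: Balaban1984PropagatorsI, (1.18)–(1.20) p.20, (1.2) p.18; Balaban1985Variational, p.288, (157) p.302] -/
theorem componentwise_curlFree_of_bondAvgIter_curlFree {X : BondIdx D → MatA N} (Af : PBond P 0 → MatA N)
    (hAf : ∀ p : Plaq P 0, curl ((P.L : ℝ) ^ k) Af p = 0)
    (hXA : ∀ c : BondIdx D, X c = bondAvgIter (c.1.1 : ℕ) Af c.1.2)
    (f : StrongDual ℂ (MatA N)) (u : ℂ) (r : ℝ) :
    ∃ A : BondSpace P, dcE ((P.L : ℝ) ^ k) A = 0 ∧ (fun c => r * (u * f (X c)).re) = WithLp.ofLp (QE D A) := by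
  -- the duality functional as a real-linear map of the values
  let φL : MatA N →ₗ[ℝ] ℝ :=
    { toFun := fun B => r * (u * f B).re
      map_add' := reFunctional_add f u r
      map_smul' := fun a B => by
        rw [RingHom.id_apply, smul_eq_mul, ← algebraMap_smul ℂ a B]
        exact reFunctional_smul f u r a B }
  refine ⟨WithLp.toLp 2 fun b => φL (Af b), PiLp.ext fun p => ?_, funext fun c => ?_⟩
  · -- the components of a curl-free matrix field are curl-free
    rw [dcE_apply, PiLp.zero_apply]
    have h := congrArg φL (hAf p)
    rw [map_zero] at h
    simpa only [curl, map_smul, map_add, map_sub, smul_eq_mul] using h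
  · show φL (X c) = bondAvgIter (c.1.1 : ℕ) (fun b => φL (Af b)) c.1.2
    rw [hXA c, map_bondAvgIter φL (le_trans (Nat.lt_succ_iff.mp c.1.1.isLt) D.hk)]

/-- **★★ `H_V(QA_f)` IS CURL-FREE FOR EVERY CURL-FREE FINE MATRIX FIELD `A_f`** (`curlA_extension_eq_zero_of_componentwise_curlFree` ∘
`componentwise_curlFree_of_bondAvgIter_curlFree`) — print's (168) remark «the pure-gauge summand is not seen by the gauge-invariant norms» for the R0′ shift in
its natural generality (on the torus: pure gauges plus constant one-forms). [cite: Balaban1985Variational, (168) p.304, (157) p.302; Balaban1984PropagatorsII, (2.35) p.228; Balaban1984PropagatorsI, (1.18) p.20] -/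
theorem curlA_extension_eq_zero_of_bondAvgIter_curlFree
    {HV : (BondIdx D → MatA N) →ₗ[ℂ] (PBond P 0 → MatA N)}
    (hHV : ∀ (A : BondIdx D → MatA N) (b : PBond P 0), HV A b = ∑ c, ((flatH P k D (Pi.single c 1) b : ℝ) : ℂ) • A c)
    {X : BondIdx D → MatA N} (Af : PBond P 0 → MatA N)
    (hAf : ∀ p : Plaq P 0, curl ((P.L : ℝ) ^ k) Af p = 0)
    (hXA : ∀ c : BondIdx D, X c = bondAvgIter (c.1.1 : ℕ) Af c.1.2)
    (y : Site P 0) (ν μ : Fin P.d) :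
    Sect2.curlA (P.eta k) (HV X) y ν μ = 0 :=
  curlA_extension_eq_zero_of_componentwise_curlFree hHV (componentwise_curlFree_of_bondAvgIter_curlFree Af hAf hXA) y ν μ

end CurlFree

/-! ## §2  The shift summand's three letters at a LEVEL-UNIFORM datum (the size line's `H`-half) -/

section Letters

open T4Continuum (T4Family)
open Summit.QuantumFields.YangMills.Theorems.FlatCubeOpsText (Adm22 distBI)
open Summit.QuantumFields.YangMills.Theorems.HalvingQuarterCubeSeq (distBI_nonneg)
open Summit.QuantumFields.YangMills.BalabanUVNodes.N07LocalLettersHBSummand (letters10On_HB_of_core_adm22_T4)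

open scoped Classical in
/-- **★ THE THREE (165)-LETTERS OF THE SHIFT SUMMAND `H_V X` ON A WINDOW OF TOP-LEVEL SITES, AT A LEVEL-UNIFORM DATUM** — dag-n07-w4's
`letters10On_HB_of_core_adm22_T4` (k0-s1-w3's S5 socket P12 ∘ the componentwise extension) at the constants `(C_d, M_Δ, ε₁, ε, θ, R′) := (1, 1, ς, ς, 8CB₃, 0)`:
if the matrix datum obeys `‖X(c)‖ ≤ ς·L^{(K−n)−j(c)}` at EVERY cell `c` (the shape of road R0′'s shear datum `∂_cλ`, `ς` = O(σ) in the letters of row (r4):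
g0's located size line, cell bus 2026-08-28 I.30279), then `Letters10On Y η_{K−n} t (H_V X)` for every `t > 2CB₃ς` — NO collar to the lower cells and NO (163′)
condition for THIS summand (print's far radius is not used: the near shape holds at every top cell with `distBI ≥ 0`, the far shape verbatim below).  This is the
`t`-letter input of `N07PureGaugeShift168.regularTwo_of_curlFreeShift` for `G := H_V X` (its first two members; the third is even `0` by §1).
[cite: Balaban1985Variational, (161) p.303, (164)–(165) p.304, (168) p.304, p.288; Balaban1984PropagatorsII, (2.60) p.234, Cor. 2.8 (2.150)–(2.151) p.249] -/
theorem letters10On_extension_of_uniformDatum_adm22_T4 (F : T4Family) (N : ℕ) [NeZero N] :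
    ∃ (Mh₀ R₀ : ℕ) (C δ₀ δ₁ B₃ : ℝ), 0 ≤ C ∧ 0 < δ₀ ∧ 0 < δ₁ ∧ 0 < B₃ ∧
    ∀ (n K : ℕ) (_ : 1 ≤ K - n) (_ : K - n + 1 ≤ F.m + K) {Mh R a' : ℕ} (_ : Mh = F.L ^ a') (_ : Mh₀ ≤ Mh) (_ : R₀ ≤ R) (_ : a' + 3 ≤ F.m + n)
      (D : Domains (F.P K)) (_ : D.k = K - n) (_ : Adm22 D R (F.L * Mh))
      (w : ℕ → PBond (F.P K) 0 → ℝ) (_ : IsLevWeight (F.P K) (K - n) D w)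
      {Y : Set (Site (F.P K) 0)} (_ : ∀ x ∈ Y, D.InOm (K - n) x)
      {HV : (BondIdx D → MatA N) →ₗ[ℂ] (PBond (F.P K) 0 → MatA N)}
      (_ : ∀ (A : BondIdx D → MatA N) (b : PBond (F.P K) 0), HV A b = ∑ c, ((flatH (F.P K) (K - n) D (Pi.single c 1) b : ℝ) : ℂ) • A c)
      {X : BondIdx D → MatA N} {ς : ℝ} (_ : 0 ≤ ς)
      (_ : ∀ c : BondIdx D, ‖X c‖ ≤ ς * ((F.P K).L : ℝ) ^ ((K - n) - (c.1.1 : ℕ)))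
      {t : ℝ} (_ : 2 * C * B₃ * ς < t),
      Letters10On Y ((F.P K).eta (K - n)) t (HV X) := by
  obtain ⟨Mh₀, R₀, C, δ₀, δ₁, B₃, hC, hδ₀, hδ₁, hB₃, hmain⟩ := letters10On_HB_of_core_adm22_T4 F N
  refine ⟨Mh₀, R₀, C, δ₀, δ₁, B₃, hC, hδ₀, hδ₁, hB₃, ?_⟩
  intro n K hk1 hk' Mh R a' hMha hMh hR hsize D hDk hAdm w hw Y hY HV hHV X ς hς hX t ht
  have hCB : 0 ≤ C * B₃ * ς := mul_nonneg (mul_nonneg hC hB₃.le) hς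
  -- (163′) at `R′ = 0`, `θ := 8CB₃`, `C_d := 1`
  have h163 : 8 * (1 : ℝ) * C * B₃ * Real.exp (-(δ₁ * 0)) ≤ 8 * C * B₃ := by
    rw [mul_zero, neg_zero, Real.exp_zero]; linarith
  -- the bound `¼·1·max{4·1·C·B₃·ς, 8CB₃·ς} = 2CB₃ς < t`
  have hq : 1 / 4 * (1 : ℝ) * max (4 * 1 * C * B₃ * ς) (8 * C * B₃ * ς) < t := by
    rw [max_eq_right (by linarith)]; linarith
  refine hmain n K hk1 hk' hMha hMh hR hsize D hDk hAdm w hw (Cd := 1) (MΔ := 1) (ε₁ := ς) (θ := 8 * C * B₃) (R' := 0)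
    (ε := fun _ => ς) zero_le_one zero_le_one hς hς (fun _ _ => by linarith) h163 hY (fun b _ c _ => distBI_nonneg D b c) hHV
    (fun b _ c hc => ?_) (fun c _ => ?_) hq
  · -- near (top cells): `‖X c‖ ≤ ς = ς·L⁰ ≤ ς·(distBI + 1)`
    have h := hX c
    rw [hc, Nat.sub_self, pow_zero, mul_one] at h
    have hd := distBI_nonneg D b c
    nlinarith
  · -- far (lower cells): verbatim
    simpa only [one_mul] using hX c

end Letters

/-! ## §3  Both members of the class (2) under road R0′'s shift — g0's kernel with the curl binder discharged -/

section RegularTwo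

variable [NeZero N] {k : ℕ} {D : Domains P}

open B15DeterminingSets
open B12RegularSpaces111 (gaugeU expI)
open Summit.QuantumFields.YangMills.BalabanUVNodes.N07PureGaugeShift168 (regularTwo_of_curlFreeShift)

open scoped Classical in
/-- **★★ BOTH MEMBERS OF (2) INSIDE `Y` WHEN THE POTENTIAL IS `A₀ + H_V X`, `X` COMPONENTWISE AN AVERAGED FINE PURE GAUGE** — g0's
`N07PureGaugeShift168.regularTwo_of_curlFreeShift` at the unit `ξ := η_k` (`0 < η_k ≤ 1` supplied) with its `hG` binder DISCHARGED by
`curlA_extension_eq_zero_of_componentwise`: under the gauge equation for `A₀ + H_V X` on the bonds of `Y`, `‖A₀ + H_V X‖ < t` on the bonds,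
`‖∇^{η_k}(A₀ + H_V X)‖ < t` on the derivative pairs, print's part `‖∇^{η_k}A₀‖ < t₀` on the pairs and `‖∂^{η_k*}∂^{η_k}A₀‖ < t₀` on the deep bonds, and `32t ≤ 1`:
`PlaqSmallOn (plaqInside Y) ((2t₀ + 24t²)η_k²) U ∧ Sect2.CoDivSmallOn (bondsDeep Y) ((t₀ + 32·d·t²)η_k³) U`.
[cite: Balaban1985Variational, (2) p.278, (168) p.304, (157) p.302; Balaban1985RegularSpaces, (1.7)–(1.9) p.77, (1.54) p.85; Balaban1984PropagatorsII, (2.35) p.228] -/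
theorem regularTwo_of_componentwisePureGaugeShift {Y : Set (Site P 0)} {t t₀ : ℝ} {U : GaugeField P 0 (SU N)}
    (u : GaugeTransf P 0 (SU N)) (A₀ : PBond P 0 → MatA N)
    {HV : (BondIdx D → MatA N) →ₗ[ℂ] (PBond P 0 → MatA N)}
    (hHV : ∀ (A : BondIdx D → MatA N) (b : PBond P 0), HV A b = ∑ c, ((flatH P k D (Pi.single c 1) b : ℝ) : ℂ) • A c)
    {X : BondIdx D → MatA N}
    (hX : ∀ (f : StrongDual ℂ (MatA N)) (u : ℂ) (r : ℝ), ∃ m : ScalarSpace P,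
      (fun c => r * (u * f (X c)).re) = WithLp.ofLp (QE D (dE ((P.L : ℝ) ^ k) m)))
    (he : ∀ b ∈ (Sect2.regionOfSet P Y).bonds,
      gaugeU (fun x => ιSU N (u x)) (fun b' => ιSU N (U b')) b = expI (P.eta k) ((A₀ + HV X) b))
    (hA : ∀ b ∈ (Sect2.regionOfSet P Y).bonds, ‖(A₀ + HV X) b‖ < t)
    (hdA : ∀ q ∈ (Sect2.regionOfSet P Y).dpairs, ‖B12RegularSpaces111.grad (P.eta k) q.2.1 (fun y => (A₀ + HV X) ⟨y, q.2.2⟩) q.1‖ < t)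
    (hdA₀ : ∀ q ∈ (Sect2.regionOfSet P Y).dpairs, ‖B12RegularSpaces111.grad (P.eta k) q.2.1 (fun y => A₀ ⟨y, q.2.2⟩) q.1‖ < t₀)
    (h10 : ∀ b ∈ Sect2.bondsDeep Y, ‖Sect2.codiffCurlA (P.eta k) A₀ b.src b.dir‖ < t₀)
    (ht : 32 * t ≤ 1) :
    PlaqSmallOn (plaqInside Y) ((2 * t₀ + 24 * t ^ 2) * (P.eta k) ^ 2) U ∧
      Sect2.CoDivSmallOn (Sect2.bondsDeep Y) ((t₀ + 32 * P.d * t ^ 2) * (P.eta k) ^ 3) U :=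
  have hη1 : P.eta k ≤ 1 :=
    pow_le_one₀ (inv_nonneg.mpr (Nat.cast_nonneg _)) (inv_le_one_of_one_le₀ (Nat.one_le_cast.mpr P.L_pos))
  regularTwo_of_curlFreeShift u A₀ (HV X) he (curlA_extension_eq_zero_of_componentwise hHV hX) hA hdA hdA₀ h10 (eta_pos P k) hη1 ht

open scoped Classical in
/-- **★★ BOTH MEMBERS OF (2) INSIDE `Y` WHEN THE POTENTIAL IS `A₀ + H_V(Q∂M)`** (`M` a fine matrix gauge function; road R0′'s `∂μ = H(∂_cλ)`, `λ_j = Q′_jM`):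
`regularTwo_of_componentwisePureGaugeShift` ∘ `componentwise_of_bondAvgIter_grad`.
[cite: Balaban1985Variational, (2) p.278, (168) p.304, (157) p.302; Balaban1985RegularSpaces, (1.54) p.85; Balaban1984PropagatorsII, (2.35) p.228; Balaban1984PropagatorsI, (1.20) p.20] -/
theorem regularTwo_of_coarsePureGaugeShift {Y : Set (Site P 0)} {t t₀ : ℝ} {U : GaugeField P 0 (SU N)}
    (u : GaugeTransf P 0 (SU N)) (A₀ : PBond P 0 → MatA N)
    {HV : (BondIdx D → MatA N) →ₗ[ℂ] (PBond P 0 → MatA N)}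
    (hHV : ∀ (A : BondIdx D → MatA N) (b : PBond P 0), HV A b = ∑ c, ((flatH P k D (Pi.single c 1) b : ℝ) : ℂ) • A c)
    {X : BondIdx D → MatA N} (M : Site P 0 → MatA N)
    (hXM : ∀ c : BondIdx D, X c = bondAvgIter (c.1.1 : ℕ) (LatticeFieldCalculus.grad ((P.L : ℝ) ^ k) M) c.1.2)
    (he : ∀ b ∈ (Sect2.regionOfSet P Y).bonds,
      gaugeU (fun x => ιSU N (u x)) (fun b' => ιSU N (U b')) b = expI (P.eta k) ((A₀ + HV X) b))
    (hA : ∀ b ∈ (Sect2.regionOfSet P Y).bonds, ‖(A₀ + HV X) b‖ < t)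
    (hdA : ∀ q ∈ (Sect2.regionOfSet P Y).dpairs, ‖B12RegularSpaces111.grad (P.eta k) q.2.1 (fun y => (A₀ + HV X) ⟨y, q.2.2⟩) q.1‖ < t)
    (hdA₀ : ∀ q ∈ (Sect2.regionOfSet P Y).dpairs, ‖B12RegularSpaces111.grad (P.eta k) q.2.1 (fun y => A₀ ⟨y, q.2.2⟩) q.1‖ < t₀)
    (h10 : ∀ b ∈ Sect2.bondsDeep Y, ‖Sect2.codiffCurlA (P.eta k) A₀ b.src b.dir‖ < t₀)
    (ht : 32 * t ≤ 1) :
    PlaqSmallOn (plaqInside Y) ((2 * t₀ + 24 * t ^ 2) * (P.eta k) ^ 2) U ∧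
      Sect2.CoDivSmallOn (Sect2.bondsDeep Y) ((t₀ + 32 * P.d * t ^ 2) * (P.eta k) ^ 3) U :=
  regularTwo_of_componentwisePureGaugeShift u A₀ hHV (componentwise_of_bondAvgIter_grad M hXM) he hA hdA hdA₀ h10 ht

end RegularTwo

end Summit.QuantumFields.YangMills.BalabanUVNodes.N07PureGaugeShiftLetters

end
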